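import Summits.NavierStokesRegularity.NavierStokesRegularity.Theorems.PerpetualPumpAveragedTypeIBlowupIncubationCore
import Mathlib.Analysis.SpecialFunctions.Log.Basic
import Mathlib.Analysis.SpecialFunctions.Pow.Real

/-!
# Crux `PerpetualPump.AveragedTypeIBlowup` (stmt-NavierStokesRegularity-1835), line `Sketch`:
# stub `incubation` — phase I of the window one-step theorem (the pre-ignition horizon)

This file proves the registered stub `stub_incubation` of the line skeleton
`Cruxes/AveragedTypeIBlowup/Lines/Sketch.lean`. Data, on a horizon `[0, T]` (`T ≤ 3`,
`20 ≤ B e^{-T}`, `η e^{2T} ≤ 10⁻³`): the seeded Toda front pair in slow time, carrier `b`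
(`b(0) = B`, `b' = -b - w² + wl² - ε̄ b w + e₀`) and bond `w` (`w(0) = W₀ ≥ 0`,
`w' = w γ + ε̄ b² + e₁`, `γ ∈ [b - 2, b]`), inflow `wl` of `L²`-size `Φ₁ ≤ 2` from the dying
previous bond, memory errors `|eᵢ| ≤ η mᵢ` controlled by Duhamel majorants `mᵢ`, and NO IGNITION
on the horizon (`w² ≤ θ₀² b`). Conclusions: the bond is positive after time `0`; the carrier
stays in `[B e^{-σ} - 3/2, B e^{-σ} + Φ₁ + 1/2]`; `∫₀ᵀ w² ≤ θ₀²`; the bond majorant is slaved,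
`m₁ ≤ μ₁ + 2 w + 2 ε̄ (B+3)² σ`; the viscous drop cannot exceed the AMPLIFICATION BUDGET,
`B (1 - e^{-T}) ≤ max 0 (log (6 θ₀ √(B+4)/(ε̄ B))) + 6 (T+1) + 2`; and if `T` is an ignition
instant (`θ₀² b(T) ≤ w(T)²`) then `b(T) ≤ B - log (θ₀/(W₀ + 2 ε̄ B)) + 6 (T+1)`.

Proof. Everything up to the last two items is `incubation_core` (the bootstrap of
`…IncubationApriori`, `…IncubationMajorants`, `…IncubationCore`). Budget: if `T ≥ 1/(2B)`,
`incubation_growth_lower` gives `(19/100) ε̄ B e^{∫₀ᵀ b - 2.03 T} ≤ w(T) ≤ θ₀ √(B + 5/2)`, so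
`∫₀ᵀ b - 2.03 T ≤ log (6 θ₀ √(B+4)/(ε̄ B))`, while `∫₀ᵀ b ≥ B (1 - e^{-T}) - Φ₁ - 0.76 - 0.26 T`;
if `T < 1/(2B)` then simply `∫₀ᵀ b ≤ (B + 5/2) T ≤ 9/16`. Ignition window: `θ₀ ≤ w(T)` and
`incubation_growth_upper` give `log (θ₀/(W₀ + 2 ε̄ B)) ≤ ∫₀ᵀ b + 3ηT ≤ B - b(T) + Φ₁ + 0.16 T`.

## References

T. Tao, *Finite time blowup for an averaged three-dimensional Navier–Stokes equation*, J. Amer.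
Math. Soc. 29 (2016), §5–6 (circuit heuristics); the estimates are folklore ODE bookkeeping.
-/

noncomputable section

-- the summit namespace `…NavierStokesRegularity.NavierStokesRegularity…` is the tree convention
set_option linter.dupNamespace false

open MeasureTheory Set Filter Topology

namespace Summit.NavierStokesRegularity.NavierStokesRegularity.Theorems.PerpetualPumpAveragedTypeIBlowup

/-- **From the two-sided bound on the bond to a bound on the amplification exponent.** If
`(19/100) ε̄ B e^{Q} ≤ w ≤ θ₀ √(B + 5/2)` with `ε̄, B, θ₀ > 0`, then
`Q ≤ log (6 θ₀ √(B+4) / (ε̄ B))`. [folklore] -/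
theorem incubation_exponent_le {εb B θ₀ Q wS : ℝ} (hεb : 0 < εb) (hB : 0 < B) (hθ₀ : 0 < θ₀)
    (hgl : 19 / 100 * εb * B * Real.exp Q ≤ wS) (hwS : wS ≤ θ₀ * Real.sqrt (B + 5 / 2)) :
    Q ≤ Real.log (6 * θ₀ * Real.sqrt (B + 4) / (εb * B)) := by
  have h1 : Real.sqrt (B + 5 / 2) ≤ Real.sqrt (B + 4) := Real.sqrt_le_sqrt (by linarith)
  have h2 : θ₀ * Real.sqrt (B + 5 / 2) ≤ θ₀ * Real.sqrt (B + 4) :=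
    mul_le_mul_of_nonneg_left h1 hθ₀.le
  have hX : Real.exp Q ≤ 6 * θ₀ * Real.sqrt (B + 4) / (εb * B) := by
    rw [le_div_iff₀ (by positivity)]
    have h4 : 0 ≤ θ₀ * Real.sqrt (B + 4) := by positivity
    nlinarith
  have := Real.log_le_log (Real.exp_pos Q) hX
  rwa [Real.log_exp] at this

/-- **The amplification budget is not exceeded before ignition.** From the lower amplification
bound at `T ≥ 1/(2B)` (or the shortness of `[0, T]` otherwise), the pre-ignition size of the bond
and the carrier bookkeeping `∫₀ᵀ b ≥ B - b(T) - 0.76 θ₀² - 0.13 T`,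
`b(T) ≤ B e^{-T} + Φ₁ + 0.13 T`:
`B (1 - e^{-T}) ≤ max 0 (log (6 θ₀ √(B+4)/(ε̄ B))) + 6(T+1) + 2`. [folklore] -/
theorem incubation_budget_bound {εb B θ₀ Φ₁ T I bT wT : ℝ} (hεb : 0 < εb) (hB20 : 20 ≤ B)
    (hθ₀ : 0 < θ₀) (hθ₀' : θ₀ ≤ 1) (hΦ₁' : Φ₁ ≤ 2) (hT0 : 0 ≤ T)
    (hgl : 1 / (2 * B) ≤ T → 19 / 100 * εb * B * Real.exp (I - 203 / 100 * T) ≤ wT)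
    (hshort : T < 1 / (2 * B) → I ≤ (B + 5 / 2) * (T - 0))
    (hwT : wT ≤ θ₀ * Real.sqrt (B + 5 / 2))
    (hL1 : B - bT - 19 / 25 * θ₀ ^ 2 - 13 / 100 * T ≤ I)
    (hK2 : bT ≤ B * Real.exp (-T) + Φ₁ + 13 / 100 * T) :
    B * (1 - Real.exp (-T)) ≤
      max 0 (Real.log (6 * θ₀ * Real.sqrt (B + 4) / (εb * B))) + 6 * (T + 1) + 2 := by
  have hθ₀1 : θ₀ ^ 2 ≤ 1 := by nlinarith
  have hB : 0 < B := by linarith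
  have hmax0 : 0 ≤ max 0 (Real.log (6 * θ₀ * Real.sqrt (B + 4) / (εb * B))) := le_max_left _ _
  rcases le_or_gt (1 / (2 * B)) T with hle | hlt
  · have hQ := incubation_exponent_le hεb hB hθ₀ (hgl hle) hwT
    have hQ' : I - 203 / 100 * T ≤ max 0 (Real.log (6 * θ₀ * Real.sqrt (B + 4) / (εb * B))) :=
      hQ.trans (le_max_right _ _)
    nlinarith
  · have h1 := hshort hlt
    have h2 : (B + 5 / 2) * T ≤ (B + 5 / 2) * (1 / (2 * B)) :=
      mul_le_mul_of_nonneg_left hlt.le (by linarith)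
    have h3 : (B + 5 / 2) * (1 / (2 * B)) ≤ 9 / 16 := by
      rw [← mul_div_assoc, mul_one, div_le_iff₀ (by positivity)]
      linarith
    nlinarith

/-- **Upper end of the ignition window.** From the upper amplification bound, `θ₀ ≤ w(T)` at an
ignition instant and the carrier bookkeeping `∫₀ᵀ b ≤ B - b(T) + Φ₁ + 0.13 T`:
`b(T) ≤ B - log (θ₀/(W₀ + 2 ε̄ B)) + 6(T+1)`. [folklore] -/
theorem incubation_window_upper {εb B θ₀ η W₀ Φ₁ T I bT wT : ℝ} (hεb : 0 < εb) (hB : 0 < B)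
    (hθ₀ : 0 < θ₀) (hη' : η ≤ 1 / 100) (hW₀ : 0 ≤ W₀) (hΦ₁' : Φ₁ ≤ 2) (hT0 : 0 ≤ T)
    (hgu : wT ≤ Real.exp (I + 3 * η * T) * (W₀ + 2 * εb * B)) (hwθ : θ₀ ≤ wT)
    (hL2 : I ≤ B - bT + Φ₁ + 13 / 100 * T) :
    bT ≤ B - Real.log (θ₀ / (W₀ + 2 * εb * B)) + 6 * (T + 1) := by
  have hden : 0 < W₀ + 2 * εb * B := by positivity
  have h1 : θ₀ ≤ Real.exp (I + 3 * η * T) * (W₀ + 2 * εb * B) := hwθ.trans hgu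
  have h2 := Real.log_le_log hθ₀ h1
  rw [Real.log_mul (Real.exp_pos _).ne' hden.ne', Real.log_exp] at h2
  rw [Real.log_div hθ₀.ne' hden.ne']
  nlinarith

/-- **From `w² ≤ θ₀² β`, `w ≥ 0`, `β ≤ B + 5/2` to `w ≤ θ₀ √(B + 5/2)`.** [folklore] -/
theorem incubation_sqrt_bound {w θ₀ β B : ℝ} (hθ₀ : 0 < θ₀) (hw : 0 ≤ w)
    (hpre : w ^ 2 ≤ θ₀ ^ 2 * β) (hβ : β ≤ B + 5 / 2) (hB : 0 < B) :
    w ≤ θ₀ * Real.sqrt (B + 5 / 2) := by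
  have h0 : 0 ≤ B + 5 / 2 := by linarith
  have h1 : w ^ 2 ≤ (θ₀ * Real.sqrt (B + 5 / 2)) ^ 2 := by
    rw [mul_pow, Real.sq_sqrt h0]
    nlinarith [sq_nonneg θ₀]
  exact (pow_le_pow_iff_left₀ hw (by positivity) two_ne_zero).1 h1

/-- **Registered stub `stub_incubation`** (G8, line `Sketch` of crux
`PerpetualPump.AveragedTypeIBlowup`, stmt-NavierStokesRegularity-1835): PHASE I of the window
one-step theorem for the seeded Toda front pair on a pre-ignition horizon `[0, T]` — positivity
of the bond, the carrier envelope `[B e^{-σ} - 3/2, B e^{-σ} + Φ₁ + 1/2]`, the transfer bound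
`∫₀ᵀ w² ≤ θ₀²`, the slaved bond majorant, the amplification budget
`B (1 - e^{-T}) ≤ max 0 (log (6 θ₀ √(B+4)/(ε̄ B))) + 6(T+1) + 2`, and the carrier bound
`b(T) ≤ B - log (θ₀/(W₀ + 2 ε̄ B)) + 6(T+1)` at an ignition instant. Some hypotheses of the
registered interface (`ε̄ ≤ 10⁻⁶`, `θ ≤ 1`, `0 ≤ μ₀`, `0 ≤ μ₁`, `0 ≤ Φ₁`, `W₀² < θ₀² B`,
continuity of `e₁`) are not needed by the proof. [folklore] -/
theorem stub_incubation :
    ∀ (b w γ wl m0 m1 e0 e1 : ℝ → ℝ) (B W₀ εb θ₀ θ η μ₀ μ₁ Φ₁ T : ℝ),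
      0 < εb → εb ≤ 1 / 10 ^ 6 → 0 < θ₀ → θ₀ ≤ 1 → 1 / 2 ≤ θ → θ ≤ 1 → 0 ≤ η → η ≤ 1 / 100 →
      0 ≤ μ₀ → η * μ₀ ≤ 1 / 10 → 0 ≤ μ₁ → η * μ₁ ≤ εb → η * Real.exp (2 * T) ≤ 1 / 1000 →
      0 ≤ Φ₁ → Φ₁ ≤ 2 → 0 < T → T ≤ 3 → 0 ≤ W₀ → W₀ ^ 2 < θ₀ ^ 2 * B → 20 ≤ B * Real.exp (-T) →
      ContinuousOn b (Icc 0 T) → ContinuousOn w (Icc 0 T) → ContinuousOn γ (Icc 0 T) →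
      ContinuousOn wl (Icc 0 T) → ContinuousOn m0 (Icc 0 T) → ContinuousOn m1 (Icc 0 T) →
      ContinuousOn e0 (Icc 0 T) → ContinuousOn e1 (Icc 0 T) →
      (∀ σ ∈ Ioo 0 T, HasDerivAt b (-(b σ) - (w σ) ^ 2 + (wl σ) ^ 2 - εb * b σ * w σ + e0 σ) σ) →
      (∀ σ ∈ Ioo 0 T, HasDerivAt w (w σ * γ σ + εb * (b σ) ^ 2 + e1 σ) σ) →
      (∀ σ ∈ Icc 0 T, b σ - 2 ≤ γ σ ∧ γ σ ≤ b σ) →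
      (∀ σ ∈ Icc 0 T, |e0 σ| ≤ η * m0 σ) → (∀ σ ∈ Icc 0 T, |e1 σ| ≤ η * m1 σ) →
      (∀ σ ∈ Icc 0 T, 0 ≤ m0 σ ∧ m0 σ ≤ m0 0 * Real.exp (-(θ * σ)) +
        ∫ u in (0 : ℝ)..σ, Real.exp (-(θ * (σ - u))) * |-(w u) ^ 2 + (wl u) ^ 2 - εb * b u * w u|) →
      (∀ σ ∈ Icc 0 T, 0 ≤ m1 σ ∧ m1 σ ≤ m1 0 * Real.exp (-(θ * σ)) +
        ∫ u in (0 : ℝ)..σ, Real.exp (-(θ * (σ - u))) * |w u * (γ u + 1) + εb * (b u) ^ 2|) →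
      (∀ σ ∈ Icc 0 T, ∫ u in (0 : ℝ)..σ, (wl u) ^ 2 ≤ Φ₁) →
      b 0 = B → w 0 = W₀ → m0 0 ≤ μ₀ → m1 0 ≤ μ₁ →
      (∀ σ ∈ Icc 0 T, (w σ) ^ 2 ≤ θ₀ ^ 2 * b σ) →
      (∀ σ ∈ Ioc 0 T, 0 < w σ) ∧
      (∀ σ ∈ Icc 0 T, B * Real.exp (-σ) - 3 / 2 ≤ b σ ∧ b σ ≤ B * Real.exp (-σ) + Φ₁ + 1 / 2) ∧
      (∫ u in (0 : ℝ)..T, (w u) ^ 2 ≤ θ₀ ^ 2) ∧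
      (∀ σ ∈ Icc 0 T, m1 σ ≤ μ₁ + 2 * w σ + 2 * εb * (B + 3) ^ 2 * σ) ∧
      B * (1 - Real.exp (-T)) ≤
        max 0 (Real.log (6 * θ₀ * Real.sqrt (B + 4) / (εb * B))) + 6 * (T + 1) + 2 ∧
      (θ₀ ^ 2 * b T ≤ (w T) ^ 2 → b T ≤ B - Real.log (θ₀ / (W₀ + 2 * εb * B)) + 6 * (T + 1)) := by
  intro b w γ wl m0 m1 e0 e1 B W₀ εb θ₀ θ η μ₀ μ₁ Φ₁ T hεb _ hθ₀ hθ₀' hθ _ hη hη' _ hημ₀ _ hημ₁ hηT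
    _ hΦ₁' hT hT3 hW₀ _ hBT hb hw hγ hwl hm0 hm1 he0 _ hdb hdw hγb he0m he1m hm0D hm1D hwlΦ hb0 hw0
    hm00 hm10 hpre
  have hB0 : 0 < B := by
    by_contra h
    rw [not_lt] at h
    nlinarith [Real.exp_pos (-T)]
  have hB20 : 20 ≤ B :=
    hBT.trans (mul_le_of_le_one_right hB0.le (Real.exp_le_one_iff.2 (by linarith)))
  have hθ₀1 : θ₀ ^ 2 ≤ 1 := by nlinarith
  obtain ⟨ha, hnn, hpos, hrate, hI2, hM1, hK, hL⟩ := incubation_core hεb hθ₀ hθ₀' hθ hη hη' hημ₀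
    hημ₁ hηT hΦ₁' hT.le hT3 hW₀ hBT hb hw hγ hwl hm0 hm1 he0 hdb hdw hγb he0m he1m hm0D hm1D hwlΦ
    hb0 hw0 hm00 hm10 hpre
  have hTT : T ∈ Icc 0 T := right_mem_Icc.2 hT.le
  have hwT := incubation_sqrt_bound hθ₀ (hnn T hTT) (hpre T hTT) (ha T hTT).2 hB0
  have hKlo : ∀ s ∈ Icc 0 T, B * Real.exp (-s) - 3 / 2 ≤ b s := by
    intro s hs
    have := (hK s hs).1
    have hs3 : s ≤ 3 := hs.2.trans hT3
    nlinarith [hs.1]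
  refine ⟨hpos, fun σ hσ => ⟨hKlo σ hσ, ?_⟩, ?_, fun σ hσ => ?_, ?_, fun hign => ?_⟩
  · have := (hK σ hσ).2
    have : σ ≤ 3 := hσ.2.trans hT3
    nlinarith [hσ.1]
  · have := hI2 T hTT
    nlinarith [sq_nonneg θ₀]
  · have h1 := hM1 σ hσ
    have h2 := hnn σ hσ
    have h3 : 0 ≤ εb * (B + 3) ^ 2 * σ := by
      have := hσ.1
      positivity
    linarith
  · -- the amplification budget
    refine incubation_budget_bound hεb hB20 hθ₀ hθ₀' hΦ₁' hT.le (fun hle => ?_) (fun _ => ?_)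
      hwT (hL T hTT).1 (hK T hTT).2
    · exact incubation_growth_lower hεb hB20 hW₀ hb hw hdw (fun s hs => (hrate s hs).1) ha hKlo
        hw0 hTT hle
    · exact incubation_integral_le_const hT.le (f := fun s => b s) (C := B + 5 / 2) hb
        fun s hs => (ha s hs).2
  · -- the carrier at an ignition instant
    have hgu := incubation_growth_upper hεb hη hB20 hb hw hdw (fun s hs => (hrate s hs).2) ha
      hw0 hTT
    have hwθ : θ₀ ≤ w T := by
      have hb1 : 1 ≤ b T := by linarith [(ha T hTT).1]
      have h3 : θ₀ ^ 2 ≤ (w T) ^ 2 := by nlinarith [sq_nonneg θ₀]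
      exact (pow_le_pow_iff_left₀ hθ₀.le (hnn T hTT) two_ne_zero).1 h3
    exact incubation_window_upper hεb hB0 hθ₀ hη' hW₀ hΦ₁' hT.le hgu hwθ (hL T hTT).2

end Summit.NavierStokesRegularity.NavierStokesRegularity.Theorems.PerpetualPumpAveragedTypeIBlowup

end
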